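import Summits.QuantumFields.YangMills.Theorems.UnitScaleTiltMinimiserStabilityRegPrAttainmentOfLeaves
import HarnessLib

/-!
# Route `UnitScaleTilt`, crux K1 child «MinimiserStabilityRegPr» (stmt-QuantumFields-19200), skeleton birth_v8 5b4e8467… — LOCATED: THE v8 COMPOSITION CONSUMES
# LEAF V3 ONLY THROUGH ITS EXISTENCE CLAUSE (ii); ATTAINMENT ⇐ (ii) ∧ PROP 8, AND (ii) ⇐ ATTAINMENT

Cell `ym3-torus`, width seat `ym-ust-19200-w2` (gen 0).  YM₃ on T³ is a ladder rung (R3), not the Clay problem; nothing here is a claim about the crux, d = 4 or the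
mass gap.

WHY.  In `Cruxes/…/Lines/birth_v8.lean` the V3 theorem `prop7From14_v8` (⇐ `stub_PV3A ∧ stub_PV3C ∧ stub_PV3D ∧ stub_PV3E`) is used exactly once, as the input `H7` of
`Variational.minSixAttainedAt_of_prop7_prop8`; that theorem and its two lemmas (`isMinOn_big_mem_small_of_background_T3`, `background_T3'`) project `H7` on its SECOND
clause only (`(H7 …).2`).  The first clause — [Balaban1985Variational] Prop. 7 (i) «at most one critical orbit», hence Prop. 2 ([Balaban1985RegularSpaces] Thm 2's chart,
`stub_PV3A`), the uniqueness half of Props 5–6 (`stub_PV3C`), Prop. 5 and the Sect. A laws — is IDLE for the crux as composed.  This file re-proves the three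
attainment theorems from the existence clause ALONE (§1, proofs verbatim with `H7 ↦ H7.2`), and records the converse bookkeeping (§2): the existence clause at any
`B₃ ≥ 1` follows from the attainment schema with an existential radius constant.  So, modulo the halving stub (Prop. 8), «clause (ii) of V3» and
«`T3ExistSplit.MinSixAttainedAt`» are interchangeable, and a two-stub line {`stub_halvingStep`, `stub_existMinimal` := clause (ii)} composes the crux with the v8 pen
otherwise unchanged (draft `Lines/birth_v9.lean`, not registered — the skeleton of record is the owner's).

WHAT IS PROVED (sorry-free, no definition).
§1 `isMinOn_big_mem_small_of_exist_T3`, `background_of_exist_T3`, **`minSixAttainedAt_of_exist_prop8`** — `Variational.*` with the uniqueness clause deleted from `H7`.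
§2 **`existMinimal_of_att`** — clause (ii) at every `B₃ ≥ 1` from `∃ B₃′ a₀′ a₁′ > 0, MinSixAttainedAt L a₀′ a₁′ B₃′` (`O₁ = max{1, B₃′/(L³B₃)}`; the (14)-background is idle).

HONEST SCOPE.  Prop. 7 (ii) (existence of a minimal orbit over a (14)-background) and Prop. 8 are HYPOTHESES; nothing of Bałaban's analysis is proved here.  Count-neutral
helper toward stmt-QuantumFields-19200 (`--supports`).

References: T. Bałaban, CMP 102 (1985) 277–309 [Balaban1985Variational] (Thm 1 (8) p.279, Sect. A (11)–(14) pp.279–280, Prop. 7 p.299, Prop. 8 p.304).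
-/

noncomputable section

namespace Summit.QuantumFields.YangMills.Theorems.AttainmentOfExist

open Literature.MathematicalPhysics.QuantumFieldTheory.Balaban1983to89
open T3ContinuumYM3Torus T3LowerAlongMinimisersSplit T3AvgDivergenceSplit T3ExistSplit T3Thm1Carrier T3SectASteps
open T3PrintedRegularMinimiser T3PrintedMinimiserExistence T3ConstrainedMinimiser
open T3UnitLawDensityEML (ℰp)
open B11 (Prop8Printed SectFPrinted)

/-! ## §1 Attainment from the existence clause of V3 and Prop. 8 (the `Variational.*` proofs with `H7 ↦ H7.2`) -/

/-- **PROP 7 (second clause, global reading R1) ∧ PROP 8 FROM A BACKGROUND WITH (14)**, at one d = 3 carrier: for a (7)-datum `V` of height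
`n < K`, `0 < ε₁ ≤ a₁` (`a₁ ≤ a₁′`, `a₁ ≤ a₅/(O₁L³B₃)`, `O₁ ≥ 1`, `B₃ > 0`) and a background `U₀ ∈ 𝔘_k(L³B₃ε₁)` with `Ū₀ = V`, there is `U` in
the SMALL fibre (8)(B₃ε₁) which minimises the Wilson action over the BIG fibre (6)(O₁L³B₃ε₁) (Prop 7's minimal orbit is critical in reading R2,
and Prop 8 applies since `O₁L³B₃ε₁ ≤ a₅`). [cite: Balaban1985Variational, Prop. 7 p.299 and Prop. 8 p.304] -/
theorem isMinOn_big_mem_small_of_exist_T3 {L : ℕ} (hL : 1 < L) {B₃ a₁' O₁ a₅ a₁ : ℝ} (hB₃ : 0 < B₃) (hO₁ : 1 ≤ O₁)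
    (h1 : a₁ ≤ a₁') (h3 : a₁ ≤ a₅ / (O₁ * (L : ℝ) ^ 3 * B₃))
    (H7 : ∀ (i : Idx L) (ε₁ : ℝ), 0 < ε₁ → ε₁ ≤ a₁' → ∀ V : (famX L i).Bdry, (famX L i).Reg7 ε₁ V →
      ∀ U₀ : (famX L i).Cfg, (famX L i).InU ((L : ℝ) ^ 3 * B₃ * ε₁) U₀ → (famX L i).InB V U₀ →
        ∃ U : (famX L i).Cfg, (famX L i).OnMinimalOrbit (O₁ * (L : ℝ) ^ 3 * B₃ * ε₁) V U)
    (H8 : ∀ (i : Idx L) (ε₀ ε₁ : ℝ), 0 < ε₁ → ∀ (V : (famX L i).Bdry) (U : (famX L i).Cfg),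
      (famX L i).Reg7 ε₁ V → (famX L i).InU ε₀ U → (famX L i).InB V U → (famX L i).IsCritical V U → ε₀ ≤ a₅ → (famX L i).InU (B₃ * ε₁) U)
    (F : T3Family) (hF : F.L = L) {n K : ℕ} (hnK : n < K) {ε₁ : ℝ} (hε₁ : 0 < ε₁) (hε₁a : ε₁ ≤ a₁)
    (V : GaugeField (F.P n) 0 (Matrix.specialUnitaryGroup (Fin 2) ℂ)) (hV : PlaqSmall ε₁ V)
    (U₀ : GaugeField (F.P K) 0 (Matrix.specialUnitaryGroup (Fin 2) ℂ)) (hU₀ : RegPr F n K ((L : ℝ) ^ 3 * B₃ * ε₁) U₀)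
    (hU₀B : U₀ ∈ fibre F ℰp n K hnK.le V) :
    ∃ U ∈ regFibrePr F n K hnK.le (B₃ * ε₁) V,
      IsMinOn (fun W : GaugeField (F.P K) 0 (Matrix.specialUnitaryGroup (Fin 2) ℂ) => wilsonAction4 W)
        (regFibrePr F n K hnK.le (O₁ * (L : ℝ) ^ 3 * B₃ * ε₁) V) U := by
  have hL1 : (1 : ℝ) ≤ L := by exact_mod_cast hL.le
  have hK : 0 < O₁ * (L : ℝ) ^ 3 * B₃ := by positivity
  have hbig : 0 < O₁ * (L : ℝ) ^ 3 * B₃ * ε₁ := mul_pos hK hε₁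
  -- Prop 8's window: `O₁L³B₃ε₁ ≤ a₅`
  have hε₀a₅ : O₁ * (L : ℝ) ^ 3 * B₃ * ε₁ ≤ a₅ := by
    have hKa : a₁ * (O₁ * (L : ℝ) ^ 3 * B₃) ≤ a₅ := (le_div_iff₀ hK).1 h3
    nlinarith [mul_le_mul_of_nonneg_left hε₁a hK.le]
  -- Prop 7, second clause: a global minimiser over the big fibre
  obtain ⟨U, hU⟩ := H7 ⟨(F, n, K), hF, hnK⟩ ε₁ hε₁ (hε₁a.trans h1) V hV U₀ hU₀ hU₀B
  obtain ⟨hUmem, hUmin⟩ := (onMinimalOrbit_iff _ V U).mp hU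
  -- it is critical in reading R2, so Prop 8 puts it in (8)(B₃ε₁)
  have hcrit : (famX L ⟨(F, n, K), hF, hnK⟩).IsCritical V U := ⟨_, hbig, hUmem, hUmin⟩
  have hIn : (famX L ⟨(F, n, K), hF, hnK⟩).InU (O₁ * (L : ℝ) ^ 3 * B₃ * ε₁) U := ((mem_regFibrePr_iff F).mp hUmem).2
  have hB : (famX L ⟨(F, n, K), hF, hnK⟩).InB V U := hUmem.1.1
  have h8U : RegPr F n K (B₃ * ε₁) U := H8 ⟨(F, n, K), hF, hnK⟩ _ ε₁ hε₁ V U hV hIn hB hcrit hε₀a₅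
  exact ⟨U, (mem_regFibrePr_iff F).mpr ⟨hB, h8U⟩, hUmin⟩

/-! ## §2 The background supply of Sect. A from Prop 7 ∧ Prop 8 only -/

/-- **THE BACKGROUND SUPPLY OF SECT. A** for the d = 3 carriers (induction on `k = K − n`; p. 279 «Theorem 1 will be proved by induction with respect
to k», (11)–(14) pp. 279–280), from Prop 7-from-(14) and Prop 8 ONLY (`B₃ > 4` for the `k = 1` background «U₀ = V₀», `T3SectASteps.sat14_base`;
for `k + 1` the (8)-member produced by §1 at height `n + 1` over `V₀ = secTo V`, lifted by (12)–(13), `mem_regFibrePr_height_succ`, `C₁ = L³`) —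
the sibling `Variational.background_T3` without its Sect. F hypothesis. [cite: Balaban1985Variational, Sect. A (11)-(14) pp.279-280] -/
theorem background_of_exist_T3 {L : ℕ} (hL : 1 < L) {B₃ a₁' O₁ a₅ a₁ : ℝ} (hB₃ : 4 < B₃) (hO₁ : 1 ≤ O₁)
    (h1 : a₁ ≤ a₁') (h3 : a₁ ≤ a₅ / (O₁ * (L : ℝ) ^ 3 * B₃))
    (H7 : ∀ (i : Idx L) (ε₁ : ℝ), 0 < ε₁ → ε₁ ≤ a₁' → ∀ V : (famX L i).Bdry, (famX L i).Reg7 ε₁ V →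
      ∀ U₀ : (famX L i).Cfg, (famX L i).InU ((L : ℝ) ^ 3 * B₃ * ε₁) U₀ → (famX L i).InB V U₀ →
        ∃ U : (famX L i).Cfg, (famX L i).OnMinimalOrbit (O₁ * (L : ℝ) ^ 3 * B₃ * ε₁) V U)
    (H8 : ∀ (i : Idx L) (ε₀ ε₁ : ℝ), 0 < ε₁ → ∀ (V : (famX L i).Bdry) (U : (famX L i).Cfg),
      (famX L i).Reg7 ε₁ V → (famX L i).InU ε₀ U → (famX L i).InB V U → (famX L i).IsCritical V U → ε₀ ≤ a₅ → (famX L i).InU (B₃ * ε₁) U) :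
    ∀ (k : ℕ) (F : T3Family), F.L = L → ∀ (n K : ℕ) (hnK : n < K), K - n = k + 1 → ∀ ε₁ : ℝ, 0 < ε₁ → ε₁ ≤ a₁ →
      ∀ V : GaugeField (F.P n) 0 (Matrix.specialUnitaryGroup (Fin 2) ℂ), PlaqSmall ε₁ V →
        ∃ U₀ : GaugeField (F.P K) 0 (Matrix.specialUnitaryGroup (Fin 2) ℂ),
          RegPr F n K ((L : ℝ) ^ 3 * B₃ * ε₁) U₀ ∧ U₀ ∈ fibre F ℰp n K hnK.le V := by
  have hB₃0 : 0 < B₃ := by linarith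
  intro k
  induction k with
  | zero =>
    -- `k = 1`: «we take simply U₀ = V₀»
    intro F hF n K hnK hk ε₁ hε₁ _ V hV
    have hK : K = n + 1 := by omega
    subst hK
    have hFL : ((F.L : ℕ) : ℝ) = (L : ℝ) := by rw [hF]
    obtain ⟨hreg, hfib⟩ := sat14_base F n hB₃ hε₁ hV
    rw [hFL] at hreg
    exact ⟨secTo F n (n + 1) (Nat.le_succ n) V, hreg, hfib⟩
  | succ k ih =>
    -- `k ↦ k + 1`: the (8)-member at height `n + 1` over `V₀ = secTo V`, lifted by (12)–(13)
    intro F hF n K hnK hk ε₁ hε₁ hε₁a V hV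
    have hnK' : n + 1 < K := by omega
    have hFL : ((F.L : ℕ) : ℝ) = (L : ℝ) := by rw [hF]
    have hV₀reg : PlaqSmall ε₁ (secTo F n (n + 1) (Nat.le_succ n) V) := plaqSmall_secTo F (Nat.le_succ n) hε₁ hV
    -- the inductive hypothesis at height `n + 1`, then §1 there
    obtain ⟨U₁, hU₁, hU₁B⟩ := ih F hF (n + 1) K hnK' (by omega) ε₁ hε₁ hε₁a _ hV₀reg
    obtain ⟨U', hU'mem, -⟩ := isMinOn_big_mem_small_of_exist_T3 hL hB₃0 hO₁ h1 h3 H7 H8 F hF hnK' hε₁ hε₁a _ hV₀reg U₁ hU₁ hU₁B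
    -- (12)–(13): the lift to the height `n`, `C₁ = L³`
    have h13 := mem_regFibrePr_height_succ F hnK'.le (mul_pos hB₃0 hε₁).le hU'mem
    obtain ⟨hfib, hreg⟩ := (mem_regFibrePr_iff F).mp h13
    refine ⟨U', ?_, hfib⟩
    rw [← hFL, mul_assoc]
    exact hreg

/-! ## §3 Attainment over (6)(ε₀) from Prop 7-from-(14) and Prop 8; the stub from three leaves -/

/-- **V5 ⇐ V3 ∧ V2 — ATTAINMENT OVER PRINT'S REGULAR FIBRE (6)(ε₀) FROM PROP 7-FROM-(14) (global reading R1) AND PROP 8 AT THE SAME `B₃ > 4`**: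
with `a₁ := min{a₁′, a₅/(O₁L³B₃)}`, `â₁ := a₁`, `â₀ := O₁L³B₃·a₁`: for every member `F` of block size `L`, heights `n < K`, `0 < ε₁ ≤ â₁`,
`B₃ε₁ ≤ ε₀ ≤ â₀` and every (7)-datum `V`, the Wilson action attains its infimum over `regFibrePr F n K _ ε₀ V` — in the LOW window
`ε₀ ≤ O₁L³B₃ε₁` at the global minimiser over (6)(O₁L³B₃ε₁), which lies in (8)(B₃ε₁) ⊆ (6)(ε₀) by Prop 8; in the HIGH window `O₁L³B₃ε₁ < ε₀`
at the global minimiser over (6)(O₁L³B₃ε₁′) = (6)(ε₀) for `ε₁′ := ε₀/(O₁L³B₃) ≥ ε₁` (the datum is (7)-small at `ε₁′`); backgrounds from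
`background_of_exist_T3`.  = the registered stub `stub_minSixAttained` (`T3ExistSplit.MinSixAttainedAt`, located gap G-K1aR-2′) DISCHARGED from the
two printed leaves. [cite: Balaban1985Variational, Prop. 7 p.299 and Prop. 8 p.304] -/
theorem minSixAttainedAt_of_exist_prop8 {L : ℕ} (hL : 1 < L) {B₃ : ℝ} (hB₃ : 4 < B₃)
    (H7 : ∃ a₁' O₁ : ℝ, 0 < a₁' ∧ 1 ≤ O₁ ∧ ∀ (i : Idx L) (ε₁ : ℝ), 0 < ε₁ → ε₁ ≤ a₁' → ∀ V : (famX L i).Bdry, (famX L i).Reg7 ε₁ V →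
      ∀ U₀ : (famX L i).Cfg, (famX L i).InU ((L : ℝ) ^ 3 * B₃ * ε₁) U₀ → (famX L i).InB V U₀ →
        ∃ U : (famX L i).Cfg, (famX L i).OnMinimalOrbit (O₁ * (L : ℝ) ^ 3 * B₃ * ε₁) V U)
    (H8 : Prop8Printed B₃ (famX L)) :
    ∃ â₀ â₁ : ℝ, 0 < â₀ ∧ 0 < â₁ ∧ MinSixAttainedAt L â₀ â₁ B₃ := by
  obtain ⟨a₁', O₁, ha₁', hO₁, H7⟩ := H7
  obtain ⟨a₅, ha₅, H8⟩ := H8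
  have hB₃0 : 0 < B₃ := by linarith
  have hL1 : (1 : ℝ) ≤ L := by exact_mod_cast hL.le
  have hK : 0 < O₁ * (L : ℝ) ^ 3 * B₃ := by positivity
  -- the final `a₁`
  set a₁ : ℝ := min a₁' (a₅ / (O₁ * (L : ℝ) ^ 3 * B₃)) with ha₁_def
  have ha₁ : 0 < a₁ := lt_min ha₁' (div_pos ha₅ hK)
  have h1 : a₁ ≤ a₁' := min_le_left _ _
  have h3 : a₁ ≤ a₅ / (O₁ * (L : ℝ) ^ 3 * B₃) := min_le_right _ _
  have hbg := background_of_exist_T3 hL hB₃ hO₁ h1 h3 H7 H8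
  refine ⟨O₁ * (L : ℝ) ^ 3 * B₃ * a₁, a₁, mul_pos hK ha₁, ha₁, ?_⟩
  intro F hF n K hnK ε₁ ε₀ hε₁ hε₁a hlo hhi V hV
  by_cases hcase : ε₀ ≤ O₁ * (L : ℝ) ^ 3 * B₃ * ε₁
  · -- LOW window: the global minimiser over (6)(O₁L³B₃ε₁) lies in (8)(B₃ε₁) ⊆ (6)(ε₀)
    obtain ⟨U₀, hU₀, hU₀B⟩ := hbg (K - n - 1) F hF n K hnK (by omega) ε₁ hε₁ hε₁a V hV
    obtain ⟨U, hU8, hUmin⟩ :=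
      isMinOn_big_mem_small_of_exist_T3 hL hB₃0 hO₁ h1 h3 H7 H8 F hF hnK hε₁ hε₁a V hV U₀ hU₀ hU₀B
    exact ⟨U, regFibrePr_mono F hlo V hU8, hUmin.on_subset (regFibrePr_mono F hcase V)⟩
  · -- HIGH window: the datum is (7)-small at `ε₁′ := ε₀/(O₁L³B₃) ∈ (ε₁, a₁]`
    rw [not_le] at hcase
    have hε₀ : 0 < ε₀ := (mul_pos hK hε₁).trans hcase
    set ε₁' : ℝ := ε₀ / (O₁ * (L : ℝ) ^ 3 * B₃) with hε₁'_def
    have hε₁' : 0 < ε₁' := div_pos hε₀ hK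
    have hε₁le : ε₁ ≤ ε₁' := by
      rw [hε₁'_def, le_div_iff₀ hK]
      nlinarith
    have hε₁'a : ε₁' ≤ a₁ := by
      rw [hε₁'_def, div_le_iff₀ hK]
      nlinarith
    have heq : O₁ * (L : ℝ) ^ 3 * B₃ * ε₁' = ε₀ := by
      rw [hε₁'_def]
      field_simp
    have hV' : PlaqSmall ε₁' V := plaqSmall_of_le hε₁le hV
    obtain ⟨U₀, hU₀, hU₀B⟩ := hbg (K - n - 1) F hF n K hnK (by omega) ε₁' hε₁' hε₁'a V hV'
    obtain ⟨U, hU⟩ := H7 ⟨(F, n, K), hF, hnK⟩ ε₁' hε₁' (hε₁'a.trans h1) V hV' U₀ hU₀ hU₀B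
    obtain ⟨hUmem, hUmin⟩ := (onMinimalOrbit_iff _ V U).mp hU
    rw [heq] at hUmem hUmin
    exact ⟨U, hUmem, hUmin⟩

/-! ## §2 The existence clause from the attainment schema -/

/-- **CLAUSE (ii) OF V3 FROM ATTAINMENT** at every `B₃ ≥ 1`: with `O₁ = max{1, B₃′/(L³B₃)}` and `a₁′ := min{â₁, â₀/(O₁L³B₃)}`, the minimiser over (6)(O₁L³B₃ε₁) given by
`MinSixAttainedAt L â₀ â₁ B₃′` IS a configuration on a minimal orbit (reading R1); the (14)-background hypotheses are idle. [cite: Balaban1985Variational, Prop. 7 p.299, Thm 1 (8) p.279] -/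
theorem existMinimal_of_att {L : ℕ} (hL : 1 < L) {B₃ : ℝ} (hB₃ : 1 ≤ B₃)
    (hATT : ∃ B₃' a₀' a₁' : ℝ, 0 < B₃' ∧ 0 < a₀' ∧ 0 < a₁' ∧ MinSixAttainedAt L a₀' a₁' B₃') :
    ∃ a₁' O₁ : ℝ, 0 < a₁' ∧ 1 ≤ O₁ ∧ ∀ (i : Idx L) (ε₁ : ℝ), 0 < ε₁ → ε₁ ≤ a₁' → ∀ V : (famX L i).Bdry, (famX L i).Reg7 ε₁ V →
      ∀ U₀ : (famX L i).Cfg, (famX L i).InU ((L : ℝ) ^ 3 * B₃ * ε₁) U₀ → (famX L i).InB V U₀ →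
        ∃ U : (famX L i).Cfg, (famX L i).OnMinimalOrbit (O₁ * (L : ℝ) ^ 3 * B₃ * ε₁) V U := by
  have hL1 : (1 : ℝ) ≤ (L : ℝ) := by exact_mod_cast hL.le
  obtain ⟨B₃', a₀', a₁', hB₃', ha₀', ha₁', HATT⟩ := hATT
  have hK : 0 < (L : ℝ) ^ 3 * B₃ := by positivity
  set O : ℝ := max 1 (B₃' / ((L : ℝ) ^ 3 * B₃)) with hO
  have hO1 : 1 ≤ O := le_max_left _ _
  have hO0 : 0 < O := lt_of_lt_of_le one_pos hO1
  have hOK : 0 < O * ((L : ℝ) ^ 3 * B₃) := mul_pos hO0 hK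
  have hB₃'O : B₃' ≤ O * ((L : ℝ) ^ 3 * B₃) :=
    (div_le_iff₀ hK).1 (le_max_right 1 (B₃' / ((L : ℝ) ^ 3 * B₃)))
  refine ⟨min a₁' (a₀' / (O * ((L : ℝ) ^ 3 * B₃))), O, lt_min ha₁' (div_pos ha₀' hOK), hO1, ?_⟩
  intro i ε₁ hε₁ hε₁a V hV U₀ _ _
  obtain ⟨⟨F, n, K⟩, hF, hnK⟩ := i
  have hε₁a₁ : ε₁ ≤ a₁' := hε₁a.trans (min_le_left _ _)
  have hlo : B₃' * ε₁ ≤ O * (L : ℝ) ^ 3 * B₃ * ε₁ := by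
    calc B₃' * ε₁ ≤ O * ((L : ℝ) ^ 3 * B₃) * ε₁ := mul_le_mul_of_nonneg_right hB₃'O hε₁.le
      _ = O * (L : ℝ) ^ 3 * B₃ * ε₁ := by ring
  have hhi : O * (L : ℝ) ^ 3 * B₃ * ε₁ ≤ a₀' := by
    have h1 : ε₁ * (O * ((L : ℝ) ^ 3 * B₃)) ≤ a₀' := (le_div_iff₀ hOK).1 (hε₁a.trans (min_le_right _ _))
    calc O * (L : ℝ) ^ 3 * B₃ * ε₁ = ε₁ * (O * ((L : ℝ) ^ 3 * B₃)) := by ring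
      _ ≤ a₀' := h1
  obtain ⟨U, hU, hmin⟩ := HATT F hF n K hnK ε₁ (O * (L : ℝ) ^ 3 * B₃ * ε₁) hε₁ hε₁a₁ hlo hhi V hV
  exact ⟨U, (onMinimalOrbit_iff _ V U).mpr ⟨hU, hmin⟩⟩

end Summit.QuantumFields.YangMills.Theorems.AttainmentOfExist

end
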